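import Literature.AnabelianGeometry.AbsoluteAnabelian.AbsTopII.InertiaGroupsLogPoints

/-!
# [AbsTopII] Prop 1.3 (x): the v2 predicate is the case `pt = id` of the v3 predicate (PROOF-ONLY)

S. Mochizuki, *Topics in Absolute Anabelian Geometry II* [AbsTopII] (bib `MochizukiAbsTopII2013`, kurims
manuscript `paper:url-585b8d0ad0d9`), §1 Prop 1.3 (x) p. 12.

No definition.  Bridges for FINDING F-L4t6g6-1 (abc-iut-L4-t6): `prop_1_3_x'_iff_forall_prop13x` — the
v2 predicate `Prop_1_3_x'` (`∀ τ : X.LogPointData`, label free) IS "every labelled section satisfies the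
printed clauses", i.e. `Prop_1_3_x'' X id`; `prop_1_3_x''_of_prop_1_3_x'` — hence it implies the v3
predicate for EVERY family (the repair is the weaker, faithful direction; the converse fails by the
certificates of `Prop13xLabelScope.lean`); `prop_1_3_x''_of_isEmpty` — a datum with no log points
satisfies (x) vacuously (satisfiability floor).  Typed ≠ proved; nothing here bears on [IUTchIII] Cor 3.12.
-/

namespace Literature.AnabelianGeometry.AbsoluteAnabelian.AbsTopII.DPSCIndexData

universe u

variable (X : DPSCIndexData.{u})

/-- The v2 predicate is "EVERY labelled section satisfies the printed clauses".
[cite: MochizukiAbsTopII2013, Prop 1.3 (x) p.12] -/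
theorem prop_1_3_x'_iff_forall_prop13x : X.Prop_1_3_x' ↔ ∀ τ : X.LogPointData, τ.Prop13x :=
  Iff.rfl

/-- … i.e. the case `pt = id` of the v3 predicate. [cite: MochizukiAbsTopII2013, Prop 1.3 (x) p.12] -/
theorem prop_1_3_x'_iff_prop_1_3_x''_id : X.Prop_1_3_x' ↔ X.Prop_1_3_x'' (id : X.LogPointData → _) :=
  Iff.rfl

/-- Hence the v2 predicate implies the v3 predicate for every family of log points (and is strictly
stronger: it is refuted by relabelling, `Prop13xLabelScope.lean`). [cite: MochizukiAbsTopII2013, Prop 1.3 (x) p.12] -/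
theorem prop_1_3_x''_of_prop_1_3_x' (h : X.Prop_1_3_x') {L : Type u} (pt : L → X.LogPointData) :
    X.Prop_1_3_x'' pt :=
  fun l => h (pt l)

/-- Satisfiability floor: with no log points the v3 predicate holds vacuously.
[cite: MochizukiAbsTopII2013, Prop 1.3 (x) p.12] -/
theorem prop_1_3_x''_of_isEmpty {L : Type u} [IsEmpty L] (pt : L → X.LogPointData) :
    X.Prop_1_3_x'' pt :=
  fun l => isEmptyElim l

end Literature.AnabelianGeometry.AbsoluteAnabelian.AbsTopII.DPSCIndexData
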